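import Mathlib.Data.Nat.Bitwise
import Mathlib.Data.Int.Basic

/-!
# `NoHeavyLowerTail` (crux stmt-CriticalPhenomena-4575), Sahi programme: the cell `(4,3)` — **the pair-saturation checker on `[3]^4`**
# (computable definitions only)

Support file (Sahi cell `prim-sahi`, seat `prim-sahi-typer` gen 31; `--supports stmt-CriticalPhenomena-4575`).  COMPUTABLE DEFINITIONS ONLY
(no theorems, no `sorry`); the soundness theorem — `chunkCheck m r = true` for all `r < m` implies `SahiGridPattern.PatternPos 4` — and the
`native_decide` evaluations live in companion files.

This is PART 1 (codes, masks, tables, the one-pair profile and transport); PART 2 (`…SahiPair43CheckPacked`) has the lane vectors, the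
batches and the enumeration `chunkCheck`.

ENCODING.  A point `p ∈ [3]^4` is the code `Σ_a p_a 3^a < 81` (`dg k a` = digit `a`); a set of points is a natural number used as a bit mask
(bit `k` = code `k`).  Since `native_decide` runs in the interpreter, all heavy work is done by big-integer operations acting on many
pairs at once: a BATCH of up to 1024 pairs `(A_i, B_i)` is packed into `PA = Σ_i A_i·2^{96 i}`, `PB = Σ_i B_i·2^{96 i}`, and every quantity
indexed by (pair, point) is a "lane vector" `Σ_i v_i·2^{96 i}` with `0 ≤ v_i < 2^90`.

THE CHECK (mathematics in `…SahiPairSaturation`).  `walk` enumerates every antichain `N` of `[3]^4` as the increasing array of its codes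
(lowest-candidate-first recursion; a code may be added only if incomparable to all chosen ones), carrying the axis signature.  A node
`N = {x₀ < x₁ < …}` is processed when its signature is sorted (every antichain has an axis permutation with sorted signature) and its hash
is `≡ r (mod m)` (chunk selection): every 2-colouring `N = N_A ⊔ N_B` with `x₀ ∈ N_A` and `|N_A|, |N_B| ≤ f(N)` (`f` = number of chains
of a fixed 19-chain decomposition meeting the points incomparable to `N`) determines the up-sets `A = P ∖ ↓N_A`, `B = P ∖ ↓N_B`; pairs with
a minimal element of `A` inside `B` and above a point of `N` (or vice versa) are skipped (excluded by the normal form); the others are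
appended to the batch.  For a full batch, `packedTest` computes all y-PROFILES
`c_i(y) = [y∈B_i](32·A_i(y) − ν_{A_i}(y)) − Σ_{q δ̸ y} B_i(q)(A_i(q)+A_i(y)−A_i(q̄y))` as lane vectors (offset by `BIAS`), runs the oblivious
greedy DOWNWARD TRANSPORT (every `y` in decreasing rank pulls `min(need, surplus)` from every `w ≥ y` in increasing rank — lane-wise
saturating arithmetic with a guard bit) and checks that every lane ends `≥ BIAS`; lanes that fail are re-examined one pair at a time by
`pairTest` (greedy plan, then an exact augmenting-path flow, both re-applied by the trusted `applyPlan`). [this work]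
-/

namespace Summit.CriticalPhenomena.PercolationContinuityZ3.Theorems.SahiGridPattern.Pair43

/-! ### Small iterators (no list allocation) -/

/-- `allBelow n p = p 0 && … && p (n-1)`. [this work] -/
def allBelow : ℕ → (ℕ → Bool) → Bool
  | 0, _ => true
  | n + 1, p => allBelow n p && p n

/-- Number of `k < n` with `p k`. [this work] -/
def countBelow : ℕ → (ℕ → Bool) → ℕ
  | 0, _ => 0
  | n + 1, p => countBelow n p + (if p n then 1 else 0)

/-- `foldBelow n f init = f (n-1) (… (f 0 init))`. [this work] -/
def foldBelow {σ : Type} : ℕ → (ℕ → σ → σ) → σ → σ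
  | 0, _, s => s
  | n + 1, f, s => f n (foldBelow n f s)

/-! ### Codes, digits, order -/

/-- Digit `a` (base 3) of the code `k`: the `a`-th coordinate of the encoded point (no `Nat.pow` at run time). [this work] -/
def dg (k a : ℕ) : ℕ := match a with
  | 0 => k % 3
  | 1 => k / 3 % 3
  | 2 => k / 9 % 3
  | _ => k / 27 % 3

/-- `leC i j`: the point coded by `i` is below the point coded by `j` (coordinatewise). [this work] -/
def leC (i j : ℕ) : Bool := decide (dg i 0 ≤ dg j 0) && decide (dg i 1 ≤ dg j 1) && decide (dg i 2 ≤ dg j 2) && decide (dg i 3 ≤ dg j 3)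

/-- `tdC i j`: the two coded points differ in every coordinate. [this work] -/
def tdC (i j : ℕ) : Bool := (dg i 0 != dg j 0) && (dg i 1 != dg j 1) && (dg i 2 != dg j 2) && (dg i 3 != dg j 3)

/-- Code of the third point of the Latin line through two totally distinct coded points (digit `−(i_a + j_a) mod 3`). [this work] -/
def thirdC (i j : ℕ) : ℕ :=
  (6 - dg i 0 - dg j 0) % 3 + (6 - dg i 1 - dg j 1) % 3 * 3 + (6 - dg i 2 - dg j 2) % 3 * 9 + (6 - dg i 3 - dg j 3) % 3 * 27

/-- Rank (digit sum) of a code. [this work] -/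
def rk (k : ℕ) : ℕ := dg k 0 + dg k 1 + dg k 2 + dg k 3

/-! ### 81-bit masks and tables -/

/-- The mask of the codes `k < 81` satisfying `p`. [this work] -/
def maskOf (p : ℕ → Bool) : ℕ := foldBelow 81 (fun k m => if p k then m ||| 2 ^ k else m) 0

/-- All 81 points. [this work] -/
def FULL : ℕ := maskOf fun _ => true

/-- `downT[x]` = points `≤ x`. [this work] -/
def downT : Array ℕ := Array.ofFn fun x : Fin 81 => maskOf fun y => leC y x

/-- `upT[x]` = points `≥ x`. [this work] -/
def upT : Array ℕ := Array.ofFn fun x : Fin 81 => maskOf fun y => leC x y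

/-- `cmpT[x]` = points comparable to `x` (including `x`). [this work] -/
def cmpT : Array ℕ := Array.ofFn fun x : Fin 81 => maskOf fun y => leC x y || leC y x

/-- `nextT[x]` = codes `> x` incomparable to `x` (the candidates that remain after choosing `x`). [this work] -/
def nextT : Array ℕ := Array.ofFn fun x : Fin 81 => maskOf fun y => decide (x.val < y) && !(leC x y) && !(leC y x)

/-- Points whose digit `a` is positive (they have a lower cover along axis `a`). [this work] -/
def lowOk (a : ℕ) : ℕ := maskOf fun x => dg x a != 0

/-- `tdL[y]` = the 16 pairs `(q, third point of the line through q and y)` over the points `q` totally distinct from `y`. [this work] -/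
def tdL : Array (Array (ℕ × ℕ)) :=
  Array.ofFn fun y : Fin 81 => (((List.range 81).filter fun q => tdC q y).map fun q => (q, thirdC q y)).toArray

/-- A decomposition of `[3]^4` into 19 chains (chain index of each code; symmetric chains by the hook construction). [this work] -/
def chainIdT : Array ℕ :=
  #[0, 9, 16, 3, 12, 15, 6, 7, 8, 1, 10, 17, 4, 13, 14, 5, 5, 5, 2, 11, 18, 2, 11, 11, 2, 2, 2, 0, 9, 16, 3, 12, 15, 6, 7, 7, 1, 10, 17,
    4, 13, 13, 4, 4, 4, 1, 10, 17, 1, 10, 10, 1, 1, 1, 0, 9, 16, 3, 12, 15, 6, 6, 6, 0, 9, 16, 3, 12, 12, 3, 3, 3, 0, 9, 16, 0, 9, 9,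
    0, 0, 0]

/-- Codes in decreasing rank (ties by code). [this work] -/
def descOrd : Array ℕ :=
  ((List.range 9).reverse.flatMap fun r => (List.range 81).filter fun k => rk k == r).toArray

/-- `upList[y]` = codes `w ≥ y`, `w ≠ y`, in increasing rank. [this work] -/
def upList : Array (Array ℕ) :=
  Array.ofFn fun y : Fin 81 =>
    ((List.range 9).flatMap fun r => (List.range 81).filter fun w => rk w == r && w != y.val && leC y w).toArray

/-- Union of table masks over an array of codes. [this work] -/
def orTab (T : Array ℕ) (pts : Array ℕ) : ℕ := pts.foldl (fun acc x => acc ||| T.getD x 0) 0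

/-- Number of chains of `chainIdT` meeting the mask `free`. [this work] -/
def chainCount (free : ℕ) : ℕ :=
  let cs := foldBelow 81 (fun k acc => if free.testBit k then acc ||| (1 <<< chainIdT.getD k 0) else acc) 0
  countBelow 19 fun c => cs.testBit c

/-- Complement inside `FULL` of a sub-mask of `FULL`. [this work] -/
def compl81 (x : ℕ) : ℕ := FULL ^^^ (FULL &&& x)

/-- Minimal elements of an up-set mask: points of `A` with no lower cover in `A`. [this work] -/
def minMask (A : ℕ) : ℕ :=
  A ^^^ (A &&& (((A <<< 1) &&& lowOk 0) ||| ((A <<< 3) &&& lowOk 1) ||| ((A <<< 9) &&& lowOk 2) ||| ((A <<< 27) &&& lowOk 3)))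

/-! ### Axis signature (symmetry reduction) -/

/-- An `S₄`-invariant weight of a code (a function of its digit multiset). [this work] -/
def hs (k : ℕ) : ℕ :=
  (1 + countBelow 4 fun a => dg k a == 1) + 16 * (1 + countBelow 4 fun a => dg k a == 2)

/-- Weight of a digit value. [this work] -/
def wv (v : ℕ) : ℕ := if v = 0 then 1 else if v = 1 then 1000 else 1000000

/-- Table of the signature weights `wv(x_a) · hs(x)`, indexed `[a][x]`. [this work] -/
def sigW : Array (Array ℕ) := Array.ofFn fun a : Fin 4 => Array.ofFn fun x : Fin 81 => wv (dg x a) * hs x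

/-- Signature weight lookup. [this work] -/
def sw (a x : ℕ) : ℕ := (sigW.getD a #[]).getD x 0

/-! ### Scalar (one pair at a time) profile and transport: the fall-back path -/

/-- Indicator array of a mask. [this work] -/
def indArr (A : ℕ) : Array ℤ := Array.ofFn fun k : Fin 81 => if A.testBit k then 1 else 0

/-- The profile at `y`: `[y∈B](32·A(y) − ν_A(y)) − Σ_{q δ̸ y} B(q)·(A(q) + A(y) − A(q̄y))`. [this work] -/
def profileAt (a b : Array ℤ) (y : ℕ) : ℤ :=
  let L := tdL.getD y #[]
  let s1 := L.foldl (fun s qt => s + a.getD qt.1 0) 0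
  let s2 := L.foldl (fun s qt => s + b.getD qt.1 0 * (a.getD qt.1 0 + a.getD y 0 - a.getD qt.2 0)) 0
  (if b.getD y 0 = 1 then 32 * a.getD y 0 - s1 else 0) - s2

/-- The profile of the pair of masks `(A,B)` as an array over the codes. [this work] -/
def profileArr (A B : ℕ) : Array ℤ :=
  let a := indArr A
  let b := indArr B
  Array.ofFn fun y : Fin 81 => profileAt a b y

/-- One transfer of `amt` from `w` down to `y`; ignored unless `y ≤ w` and both are codes. [this work] -/
def applyStep (c : Array ℤ) (w y amt : ℕ) : Array ℤ :=
  if leC y w && decide (w < 81) && decide (y < 81) then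
    let c1 := c.setIfInBounds w (c.getD w 0 - amt)
    c1.setIfInBounds y (c1.getD y 0 + amt)
  else c

/-- Apply a transport plan (list of `(w, y, amount)`). [this work] -/
def applyPlan : Array ℤ → List (ℕ × ℕ × ℕ) → Array ℤ
  | c, [] => c
  | c, (w, y, amt) :: rest => applyPlan (applyStep c w y amt) rest

/-- All 81 entries are nonnegative. [this work] -/
def allNonneg (c : Array ℤ) : Bool := allBelow 81 fun k => decide (0 ≤ c.getD k 0)

/-- Greedy plan: negatives in decreasing rank pull from the positives above them in increasing rank. [this work] -/
def greedyPlan (c0 : Array ℤ) : List (ℕ × ℕ × ℕ) :=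
  let res := descOrd.foldl (fun (st : Array ℤ × List (ℕ × ℕ × ℕ)) y =>
      if st.1.getD y 0 < 0 then
        (upList.getD y #[]).foldl (fun (st : Array ℤ × List (ℕ × ℕ × ℕ)) w =>
            let need := - st.1.getD y 0
            let hav := st.1.getD w 0
            if 0 < need ∧ 0 < hav then
              let t := min need hav
              ((st.1.setIfInBounds w (hav - t)).setIfInBounds y (st.1.getD y 0 + t), (w, y, t.toNat) :: st.2)
            else st) st
      else st) (c0, [])
  res.2.reverse

/-- One augmenting path of the unit-step flow search: from the supply point `w`, reach a demand point going down along `w → y`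
(`y ≤ w`) and back up along positive flow `w' → y`; returns the forward/backward steps and the visited supply points.  Fuel-bounded.
[this work] -/
def augment (t : Array ℤ) (f : Array (Array ℤ)) : ℕ → ℕ → Array Bool → Option (List (Bool × ℕ × ℕ)) × Array Bool
  | 0, _, vis => (none, vis)
  | fuel + 1, w, vis =>
    let vis := vis.setIfInBounds w true
    match (List.range 81).find? (fun y => leC y w && decide (0 < t.getD y 0)) with
    | some y => (some [(true, w, y)], vis)
    | none =>
      (List.range 81).foldl (fun (acc : Option (List (Bool × ℕ × ℕ)) × Array Bool) y =>
          match acc.1 with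
          | some _ => acc
          | none =>
            if leC y w then
              (List.range 81).foldl (fun (acc2 : Option (List (Bool × ℕ × ℕ)) × Array Bool) w' =>
                  match acc2.1 with
                  | some _ => acc2
                  | none =>
                    if !(acc2.2.getD w' false) && decide (0 < (f.getD w' #[]).getD y 0) then
                      match augment t f fuel w' acc2.2 with
                      | (some path, vis2) => (some ((true, w, y) :: (false, w', y) :: path), vis2)
                      | (none, vis2) => (none, vis2)
                    else acc2) acc
            else acc) (none, vis)

/-- Apply an augmenting path of one unit to the flow matrix. [this work] -/
def applyPath (f : Array (Array ℤ)) : List (Bool × ℕ × ℕ) → Array (Array ℤ)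
  | [] => f
  | (fwd, w, y) :: rest =>
    let row := f.getD w #[]
    let row' := row.setIfInBounds y (row.getD y 0 + (if fwd then 1 else -1))
    applyPath (f.setIfInBounds w row') rest

/-- Exact plan by unit augmentations (Ford–Fulkerson on the bipartite transport graph), fuel-bounded. [this work] -/
def flowLoop : ℕ → Array ℤ → Array ℤ → Array (Array ℤ) → Array (Array ℤ)
  | 0, _, _, f => f
  | fuel + 1, s, t, f =>
    let r := (List.range 81).foldl (fun (acc : Option (ℕ × List (Bool × ℕ × ℕ))) w =>
        match acc with
        | some _ => acc
        | none =>
          if 0 < s.getD w 0 then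
            match (augment t f 81 w (Array.replicate 81 false)).1 with
            | some path => some (w, path)
            | none => none
          else none) none
    match r with
    | none => f
    | some (w, path) =>
      let ylast := match path.getLast? with | some (_, _, y) => y | none => 0
      flowLoop fuel (s.setIfInBounds w (s.getD w 0 - 1)) (t.setIfInBounds ylast (t.getD ylast 0 - 1)) (applyPath f path)

/-- The exact fall-back plan. [this work] -/
def flowPlan (c : Array ℤ) : List (ℕ × ℕ × ℕ) :=
  let s := Array.ofFn fun k : Fin 81 => max (c.getD k 0) 0
  let t := Array.ofFn fun k : Fin 81 => max (- c.getD k 0) 0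
  let total := (List.range 81).foldl (fun acc k => acc + (t.getD k 0).toNat) 0
  let f := flowLoop total s t (Array.replicate 81 (Array.replicate 81 (0 : ℤ)))
  (List.range 81).flatMap fun w => (List.range 81).filterMap fun y =>
    let v := (f.getD w #[]).getD y 0
    if 0 < v then some (w, y, v.toNat) else none

/-- **The dual-cone test for one pair**: some downward transport plan makes the profile pointwise nonnegative. [this work] -/
def dualTest (c : Array ℤ) : Bool :=
  allNonneg (applyPlan c (greedyPlan c)) || allNonneg (applyPlan c (flowPlan c))

/-- One-pair test from the masks. [this work] -/
def pairTest (A B : ℕ) : Bool := dualTest (profileArr A B)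

end Summit.CriticalPhenomena.PercolationContinuityZ3.Theorems.SahiGridPattern.Pair43
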